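import Summits.CriticalPhenomena.LaceExpansionHighD.MeanFieldD10F3CellsRev2
import Literature.Probability.FitznerVanDerHofstad2017.NobleAppDKeyBounds
import Summits.CriticalPhenomena.LaceExpansionHighD.MeanFieldD10AppDRev2
import Summits.CriticalPhenomena.LaceExpansionHighD.MeanFieldD10HypothesesRev2
import HarnessLib

/-!
# `d = 10`, line `Rev2`: LEVEL B, part 2 — the `f₃` diagram rows (S2b) of the record IN THE KERNEL, assembled

pub-lace10 cell, TYPER seat (unit `pub-lace10-typer-g0`); lead RULINGS D7/D8/D10/D11/D14; eng E1/E3 (support numerics, not used as input);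
referee REF-CHECK-3/5.  The record `MeanFieldD10CertRev2.meanField_d10_Rev2` (p321303) is conditional on the two binders `hI`, `hS′`; LEVEL A
(`MeanFieldD10AppDRev2`, p328465) discharged their `β`-table halves by App. D in the kernel, leaving per binder «Assumption 4.3 at the input record»
AND «the seven weighted-diagram rows (S2b)».  THIS MODULE REMOVES BOTH (S2b) CONJUNCTS:

* the seven IMPROVEMENT-STEP rows `sup_{x ∈ S_k} ℋ^{n_k,l_k}_p(x) ≤ boRev2 k` on `(p_I, p_c)` are PROVED from the extended simplified form
  `NobleSimplifiedFormF3At 10 p BoRev2 EoL` (itself App. D in the kernel from Assumption 4.3 at `inputsORev2`, §1) by the `h2phi` cell chain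
  `nobleH_le_boundHD75Phi_srwTrueAlt` → the seven kernel cells of part 1 (`MeanFieldD10F3CellsRev2`: fifteen `decide +kernel` rows over `ℚ`) (§2): cells `(1,1)`, `(1,2)`, `(1,3)` over `𝒳` as
  region sups, `(0,0)`, `(1,0)` over `𝒳` per cone (`3e₁`, `2e₁+e₂`, `e₁+e₂+e₃`) and at the two shell nodes `2e₁`, `e₁+e₂`, `(1,6)` at the origin, and
  the seventh cell `(1,17,{0})` as the `e₁`-node value of `(1,16)` (`nobleH_single`, lead D11 (d));
* the seven INITIAL-POINT rows at `p_I = 1/19` are PROVED HYPOTHESIS-FREE (`nobleH_nbwThresholdI_{zero,one}_le`: `ℋ^{n,l}_{p_I} ≤ ρ^{n+1}·𝓙_{n+2,l}`,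
  `ρ = 18/19`, and the landed `𝓙` sups `CellImD10.jXQ`, `jOQ 1 6`, `JSupD10.srwJ_origin_m3l17`) against the RE-CUT table `biRev2L` (§0, §3; lead D10/D14:
  entries 5 and 6 of the record's `biRev2` padded UP to `0.0068974763` / `0.00082337997`, all other entries verbatim), with the re-cut certificate
  `nobleCertificate_d10_Rev2L` (§3, eleven `norm_num` rows; `γ, Γ, c, c_μ, Bi, Bo, bo` of the record UNCHANGED).

HEADLINE `meanField_full_d10_Rev2L_f3 : (Ass. 4.3 at inputsIRev2, p_I) → (R18-valid → ∀ p ∈ (p_I,p_c), f^{𝒮₇} ≤ GammaRev2 → Ass. 4.3 at inputsORev2, p)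
→ MeanField 10` — the `d = 10` sentence CONDITIONAL ON (S2a) ONLY, i.e. on [NoBLE17] Assumption 4.3 for percolation at the two literal input records
(the `x`-space diagrammatic bounds of [FvdH17] §§4–6 at the ST10′ cells: Levels C/U of the programme).  HONEST LABEL: still CONDITIONAL; this is the
`d = 11` «App.-D-discharged + F-IM tables» level (`MeanFieldD11AppDDischargedRev10` + `MeanFieldD11InitTables`) reached at `d = 10`, with the
`d = 10` table side entirely in the kernel (no table hypothesis remains).

References: [NoBLE17] = Fitzner–van der Hofstad, PTRF 169 (2017) 1041–1119 (`FitznerVanDerHofstad2016NoBLE`): §3.3.3 (3.28)–(3.31) p. 1070 (initial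
point), §3.3.4–§3.3.5 (3.58)–(3.87) pp. 1074–1079 (the `f₃` bound), Def. 2.9 / Prop. 2.11 pp. 1060–1061 (the certificate), Prop. 4.5 p. 1088 and App. D
(D.2), (D.3), (D.13), (D.21), (D.29) pp. 1110–1117 (the `f₃`-side constants); [FvdH17] = EJP 22 (2017) no. 43 (`FitznerVanDerHofstad2017`): Prop. 2.2 p. 11,
(2.31)–(2.35) pp. 12–13 (the cells `𝒮`), §2.5 p. 16.  Every numeral below is a programme literal (record tables of `MeanFieldD10CertRev2`, E1's 18-digit
outward `EoL`, the landed SRW tables) — NOT printed values; `[cite:]` tags are LOCATORS.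

Heartbeat census: §1 `betaF3LE_corr_inputsORev2` (`norm_num` over 60-field rationals, `maxHeartbeats 4000000` like its Level-A twins); everything else
`norm_num` on literals or term-mode composition (the fifteen kernel rows live in part 1).  `set_option Elab.async false`; no other option.
-/

set_option Elab.async false

noncomputable section

namespace Summit.CriticalPhenomena.LaceExpansionHighD

namespace D10

open Literature.Barriers.CriticalPhenomena Literature.Probability.Percolation
open Literature.Probability.LatticeModels Literature.Probability.FitznerVanDerHofstad2017
open F3Bounds F3Bounds.CellNumQ KTUD10 KSupD10 TUSupD10 JSupD10 CellSupD10 CellImD10 SlotD10 SlotD10Phi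
open KTUD10 (dq)

/-! ## §0  The re-cut initial-point table -/


/-- **The RE-CUT initial-point diagram table `biRev2L`** (lead RULINGS D10/D14): the record's `biRev2` with entry 5 (cell `(1,6,{0})`) replaced by
`0.0068974763 ≥ (18/19)²·jOQ 1 6` and entry 6 (cell `(1,17,{0})`) by `0.00082337997 ≥ (18/19)²·(dq 91740792 11)` — the tree's certified 8-digit-up `𝓙`-origin
literals exceed the record's 18-digit engine roundings by `2.7e−11` / `6.3e−12`; all other entries verbatim.  `b`-tables are intermediate engine roundings,
not part of the target sentence. [cite: FitznerVanDerHofstad2017, §2.4–§2.5 and Figure 3 (shape of the table)] [cite: FitznerVanDerHofstad2016NoBLE, §3.3.3 (3.31) p. 1070] -/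
def biRev2L : Fin 7 → ℝ := ![0.0564098664204578571, 0.0905186439061315373, 0.0370777178235925148, 0.0249663467112826778, 0.0143289728408067991,
  0.0068974763, 0.00082337997]

/-! ## §1  The `f₃`-side of App. D at `inputsORev2` (kernel) and the literal table `EoL` -/

/-- Cap `μ ≤ 7/10` at `inputsORev2` (`μ ≈ 0.0533`). [cite: FitznerVanDerHofstad2016NoBLE, App. D (D.2)–(D.3) p. 1111 (Taylor caps)] -/
theorem capMu_inputsORev2 : inputsORev2.mu ≤ 7 / 10 := by norm_num [inputsORev2]

/-- Cap `Π_α-lower ≤ 1/8` at `inputsORev2`. [cite: FitznerVanDerHofstad2016NoBLE, App. D (D.2) p. 1111] -/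
theorem capP_inputsORev2 : inputsORev2.piAlphaLower ≤ 1 / 8 := by norm_num [inputsORev2]

/-- Cap `(2d−1)·μ̄ ≤ 2d·μ` at `inputsORev2` (`19·(2031/38000) ≤ 20·μ`). [cite: FitznerVanDerHofstad2016NoBLE, App. D (D.3) p. 1111] -/
theorem capQ_inputsORev2 : (2 * ((10 : ℕ) : ℝ) - 1) * inputsORev2.mub ≤ 2 * ((10 : ℕ) : ℝ) * inputsORev2.mu := by norm_num [inputsORev2]

set_option maxHeartbeats 4000000 in
/-- `EoL` DOMINATES the kernel-computed five further constants on the window: `BetaF3LE (ofFn extra^corr(inputsORev2)) EoL` (component by component: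
(D.2) lower `c̲_Φ`, (D.3) upper `ᾱ_F`, (D.13) `β_{R,F}`, (D.21) printed `β_{ΔR,Φ}`, (D.29) `β_{|ΔR,F|}`; `norm_num`).
[cite: FitznerVanDerHofstad2016NoBLE, Assumption 2.7 (a), (c); App. D (D.2), (D.3), (D.13), (D.21), (D.29) pp. 1110–1117] -/
theorem betaF3LE_corr_inputsORev2 :
    BetaF3LE (NobleBetaF3.ofFn (BetaMap.extraOfInputsCorr ((10 : ℕ) : ℝ) inputsORev2)) EoL := by
  constructor
  · simp only [NobleBetaF3.ofFn_cΦlow, BetaMap.extraOfInputsCorr_zero, BetaMap.extraOfInputs, Matrix.cons_val_zero]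
    norm_num [BetaMap.betaCPhiLow, inputsORev2, EoL]
  · simp only [NobleBetaF3.ofFn_αFup, BetaMap.extraOfInputsCorr_one, BetaMap.extraOfInputs, Matrix.cons_val_zero, Matrix.cons_val_one]
    norm_num [BetaMap.betaAfUp, inputsORev2, EoL]
  · simp only [NobleBetaF3.ofFn_βRF, BetaMap.extraOfInputsCorr_two, BetaMap.extraOfInputs, Matrix.cons_val_two, Matrix.head_cons, Matrix.tail_cons]
    norm_num [BetaMap.betaRF, inputsORev2, EoL]
  · simp only [NobleBetaF3.ofFn_βΔRΦ, BetaMap.extraOfInputsCorr_three]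
    norm_num [BetaMap.betaRpDeltaCorr, inputsORev2, EoL]
  · simp only [NobleBetaF3.ofFn_βΔRFabs, BetaMap.extraOfInputsCorr_four, BetaMap.extraOfInputs, Matrix.cons_val_four, Matrix.head_cons, Matrix.tail_cons]
    norm_num [BetaMap.betaRfDelta, inputsORev2, EoL]

/-- **The extended simplified `f₃`-form AT THE LITERAL TABLES `(BoRev2, EoL)` on the window** from Assumption 4.3 at `p` with `inputsORev2` (App. D
`f₃`-side in the kernel by `nobleSimplifiedFormF3At_percolation_of_weaker`, weakened along `betaLE_corr_inputsORev2` (Level A) and `betaF3LE_corr_inputsORev2`).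
[cite: FitznerVanDerHofstad2016NoBLE, Prop. 4.5 p. 1088; Assumption 2.7; App. D (D.2), (D.3), (D.13), (D.21), (D.29)] [cite: FitznerVanDerHofstad2017, §2.5] -/
theorem nobleSimplifiedFormF3At_d10_Rev2_oL {p : unitInterval} (hp : p < criticalProbI 10) (hp0 : 0 < (p : ℝ))
    (h43 : NobleAssumption43At 10 p (percolationNobleSplit 10 p (by norm_num) hp) inputsORev2) :
    NobleSimplifiedFormF3At 10 p BoRev2 EoL := by
  have h := nobleSimplifiedFormF3At_percolation_of_weaker (d := 10) (hd := by norm_num) (hp := hp) hp0 inputsORev2_WF h43 n1_inputsORev2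
    n2_inputsORev2 n3_inputsORev2 n4_inputsORev2 capMu_inputsORev2 capP_inputsORev2 capQ_inputsORev2 betaLE_corr_inputsORev2
    betaF3LE_corr_inputsORev2
  simpa only [Nat.cast_ofNat] using h

/-! ## §2  (S2b) on the window from the extended simplified form — the seven improvement-step rows PROVED -/

/-- **The seven improvement-step diagram rows of the record at `p ∈ (p_I, p_c)`, PROVED** from the extended simplified form `NobleSimplifiedFormF3At 10 p BoRev2 EoL`
and `f₂(p) ≤ Γ₂ = GammaRev2 1`: `NobleWeightedDiagramBoundOf 𝒮₇ p boRev2` — witness (`exists_witness`) → `nobleH_le_boundHD75Phi_srwTrueAlt` (pointwise, no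
(H-Γ)) → the seven kernel cells of `MeanFieldD10F3CellsRev2` (the seventh via `nobleH_single`: `ℋ^{1,17}_p(0) = ℋ^{1,16}_p(e₁)`).
[cite: FitznerVanDerHofstad2016NoBLE, §3.3.5 (3.58)–(3.87) pp. 1074–1079; (3.34)–(3.35) p. 1071] [cite: FitznerVanDerHofstad2017, Prop. 2.2 p. 11; (2.31)–(2.35) pp. 12–13] -/
theorem nobleWeightedDiagramBoundOf_d10_Rev2_o {p : unitInterval} (hp : p ∈ Set.Ioo (nbwThresholdI 10) (criticalProbI 10))
    (hF3 : NobleSimplifiedFormF3At 10 p BoRev2 EoL) (hΓ2 : nobleF2 10 p ≤ GammaRev2 1) :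
    NobleWeightedDiagramBoundOf famRev2 p boRev2 := by
  have hpc : (p : ℝ) < criticalProb (zdGraph 10) (0 : Site 10) := by
    rw [← coe_criticalProbI]
    exact Subtype.coe_lt_coe.2 hp.2
  have hW := hF3.exists_witness (by norm_num) hpc hΓ2 BoRev2_αFlow_pos BoRev2_gap
  rw [toArgs_eq_aoQ] at hW
  have hle : ∀ {n : ℕ}, n ≤ 1 → ∀ (l : ℕ) (x : Site 10),
      nobleH 10 n l p x ≤ boundHD75Phi (srwTrueAlt 10 ((aoQ.afmin : ℚ) : ℝ) ((aoQ.afmax : ℚ) : ℝ)) n l x aoQ.toArgs :=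
    fun hn l x => nobleH_le_boundHD75Phi_srwTrueAlt (d := 10) (by norm_num) hpc hW (ArgsQ.toArgs_WF aoQ_wf) one_le_afmin_toArgs hn l x
  have hz : (0 : ℕ) ≤ 1 := Nat.zero_le 1
  refine nobleWeightedDiagramBoundOf_of_forall boRev2_nonneg fun k => ?_
  fin_cases k
  · show ∀ x ∈ calX 10, nobleH 10 0 0 p x ≤ boRev2 0
    exact fun x hx => ((hle hz 0 x).trans (cellX00 x hx)).trans (boQ_cast 0).le
  · show ∀ x ∈ calX 10, nobleH 10 1 0 p x ≤ boRev2 1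
    exact fun x hx => ((hle le_rfl 0 x).trans (cellX10 x hx)).trans (boQ_cast 1).le
  · show ∀ x ∈ calX 10, nobleH 10 1 1 p x ≤ boRev2 2
    exact fun x hx => ((hle le_rfl 1 x).trans (cellX11 x hx)).trans (boQ_cast 2).le
  · show ∀ x ∈ calX 10, nobleH 10 1 2 p x ≤ boRev2 3
    exact fun x hx => ((hle le_rfl 2 x).trans (cellX12 x hx)).trans (boQ_cast 3).le
  · show ∀ x ∈ calX 10, nobleH 10 1 3 p x ≤ boRev2 4
    exact fun x hx => ((hle le_rfl 3 x).trans (cellX13 x hx)).trans (boQ_cast 4).le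
  · show ∀ x ∈ ({0} : Set (Site 10)), nobleH 10 1 6 p x ≤ boRev2 5
    intro x hx
    rw [Set.mem_singleton_iff] at hx
    subst hx
    exact ((hle le_rfl 6 0).trans cellO16).trans (boQ_cast 5).le
  · show ∀ x ∈ ({0} : Set (Site 10)), nobleH 10 1 17 p x ≤ boRev2 6
    intro x hx
    rw [Set.mem_singleton_iff] at hx
    subst hx
    rw [← nobleH_single (d := 10) (by norm_num) 1 16 p hpc 0, ← Nd.pt_e1]
    exact ((hle le_rfl 16 (Nd.pt .e1)).trans cellE16).trans (boQ_cast 6).le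

/-- **Binder `hS′` of the record with (S2b) REMOVED**: if, whenever the remainder table `R18` is kernel-valid, Assumption 4.3 holds at every `p ∈ (p_I, p_c)` with
`f^{𝒮₇}_j(p) ≤ Γ_j` with the constants `inputsORev2`, then `RemValid 10 18 R18 → NobleImprovementInputsOf 𝒮₇ cMuRev2 cWeightsRev2 GammaRev2 BoRev2 boRev2`
— App. D by Level A (`β`-side) and §1 (`f₃`-side), the diagram rows by §2.
[cite: FitznerVanDerHofstad2016NoBLE, Prop. 4.5(ii) p. 1088; Assumption 4.3 pp. 1086–1087; (3.87) p. 1079] [cite: FitznerVanDerHofstad2017, Prop. 2.2 p. 11; §2.4 claim (iii) p. 13] -/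
theorem nobleImprovementInputs_d10_Rev2_f3
    (hS43 : (RemValid 10 18 fun r => ((RemCertD10.R18 r : ℚ) : ℝ)) →
      ∀ (p : unitInterval) (hp : p ∈ Set.Ioo (nbwThresholdI 10) (criticalProbI 10)),
        (∀ j, nobleFOf (nobleTripleSnoc 10 ((1 : ℕ), (17 : ℕ), ({0} : Set (Site 10)))) cMuRev2 cWeightsRev2 j p ≤ GammaRev2 j) →
          NobleAssumption43At 10 p (percolationNobleSplit 10 p (by norm_num) hp.2) inputsORev2) :
    (RemValid 10 18 fun r => ((RemCertD10.R18 r : ℚ) : ℝ)) →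
      NobleImprovementInputsOf (nobleTripleSnoc 10 ((1 : ℕ), (17 : ℕ), ({0} : Set (Site 10)))) cMuRev2 cWeightsRev2 GammaRev2 BoRev2 boRev2 := by
  intro hR p hp hΓ
  have h43 := hS43 hR p hp hΓ
  have hp0 : 0 < (p : ℝ) :=
    lt_trans (nbwThresholdI_pos (by norm_num)) (show ((nbwThresholdI 10 : unitInterval) : ℝ) < p by exact_mod_cast hp.1)
  have hF3 := nobleSimplifiedFormF3At_d10_Rev2_oL hp.2 hp0 h43
  have hΓ2 : nobleF2 10 p ≤ GammaRev2 1 := by simpa only [nobleFOf_one] using hΓ 1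
  exact ⟨hF3.toSimplifiedFormAt, nobleWeightedDiagramBoundOf_d10_Rev2_o hp hF3 hΓ2⟩

/-! ## §3  (S2b) at `p_I = 1/19`, PROVED hypothesis-free, and the re-cut certificate -/

/-- `ρ = (2d−2)/(2d−1) = 18/19` at `d = 10`. [cite: FitznerVanDerHofstad2016NoBLE, §3.3.3 (3.28)–(3.31) p. 1070] -/
theorem nbwRho_ten : nbwRho 10 = 18 / 19 := by rw [nbwRho_def]; norm_num

/-- **The seven initial-point diagram rows at `p_I`, PROVED** (no hypothesis): `NobleWeightedDiagramBoundOf 𝒮₇ p_I biRev2L` from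
`ℋ^{0,l}_{p_I} ≤ ρ·𝓙_{2,l}`, `ℋ^{1,l}_{p_I} ≤ ρ²·𝓙_{3,l}` (`NobleF3InitialPoint`) and the landed `𝓙` literals over `𝒳` / at the origin.
[cite: FitznerVanDerHofstad2016NoBLE, §3.3.3 (3.28)–(3.31) p. 1070; Assumption 2.2 p. 1058] [cite: FitznerVanDerHofstad2017, §2.4 (verification at p_I); (2.35)] -/
theorem nobleWeightedDiagramBoundOf_d10_Rev2L_pI : NobleWeightedDiagramBoundOf famRev2 (nbwThresholdI 10) biRev2L := by
  have hb : ∀ k, 0 ≤ biRev2L k := by intro k; fin_cases k <;> simp [biRev2L] <;> norm_num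
  have hz : ∀ (l : ℕ) (x : Site 10), nobleH 10 0 l (nbwThresholdI 10) x ≤ 18 / 19 * srwJ 10 2 l x := fun l x => by
    simpa only [nbwRho_ten] using nobleH_nbwThresholdI_zero_le (d := 10) (by norm_num) l x
  have ho : ∀ (l : ℕ) (x : Site 10), nobleH 10 1 l (nbwThresholdI 10) x ≤ (18 / 19) ^ 2 * srwJ 10 3 l x := fun l x => by
    simpa only [nbwRho_ten] using nobleH_nbwThresholdI_one_le (d := 10) (by norm_num) l x
  have hρ : (0 : ℝ) ≤ 18 / 19 := by norm_num
  have hρ2 : (0 : ℝ) ≤ (18 / 19) ^ 2 := by norm_num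
  refine nobleWeightedDiagramBoundOf_of_forall hb fun k => ?_
  fin_cases k
  · show ∀ x ∈ calX 10, nobleH 10 0 0 (nbwThresholdI 10) x ≤ biRev2L 0
    intro x hx
    refine (hz 0 x).trans ((mul_le_mul_of_nonneg_left (srwJ_calX_le_jXQ (m := 0) (by norm_num) (by norm_num) x hx) hρ).trans ?_)
    simp only [biRev2L, jXQ]; push_cast [dq]; norm_num
  · show ∀ x ∈ calX 10, nobleH 10 1 0 (nbwThresholdI 10) x ≤ biRev2L 1
    intro x hx
    refine (ho 0 x).trans ((mul_le_mul_of_nonneg_left (srwJ_calX_le_jXQ (m := 1) (by norm_num) (by norm_num) x hx) hρ2).trans ?_)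
    simp only [biRev2L, jXQ]; push_cast [dq]; norm_num
  · show ∀ x ∈ calX 10, nobleH 10 1 1 (nbwThresholdI 10) x ≤ biRev2L 2
    intro x hx
    refine (ho 1 x).trans ((mul_le_mul_of_nonneg_left (srwJ_calX_le_jXQ (m := 1) (by norm_num) (by norm_num) x hx) hρ2).trans ?_)
    simp only [biRev2L, jXQ]; push_cast [dq]; norm_num
  · show ∀ x ∈ calX 10, nobleH 10 1 2 (nbwThresholdI 10) x ≤ biRev2L 3
    intro x hx
    refine (ho 2 x).trans ((mul_le_mul_of_nonneg_left (srwJ_calX_le_jXQ (m := 1) (by norm_num) (by norm_num) x hx) hρ2).trans ?_)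
    simp only [biRev2L, jXQ]; push_cast [dq]; norm_num
  · show ∀ x ∈ calX 10, nobleH 10 1 3 (nbwThresholdI 10) x ≤ biRev2L 4
    intro x hx
    refine (ho 3 x).trans ((mul_le_mul_of_nonneg_left (srwJ_calX_le_jXQ (m := 1) (by norm_num) (by norm_num) x hx) hρ2).trans ?_)
    simp only [biRev2L, jXQ]; push_cast [dq]; norm_num
  · show ∀ x ∈ ({0} : Set (Site 10)), nobleH 10 1 6 (nbwThresholdI 10) x ≤ biRev2L 5
    intro x hx
    rw [Set.mem_singleton_iff] at hx
    subst hx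
    refine (ho 6 0).trans ((mul_le_mul_of_nonneg_left (srwJ_origin_le_jOQ (m := 1) (by norm_num) (by decide)) hρ2).trans ?_)
    simp only [biRev2L, jOQ]; push_cast [dq]; norm_num
  · show ∀ x ∈ ({0} : Set (Site 10)), nobleH 10 1 17 (nbwThresholdI 10) x ≤ biRev2L 6
    intro x hx
    rw [Set.mem_singleton_iff] at hx
    subst hx
    refine (ho 17 0).trans ((mul_le_mul_of_nonneg_left srwJ_origin_m3l17 hρ2).trans ?_)
    simp only [biRev2L]; push_cast [dq]; norm_num

/-- **Binder `hI` of the record with (S2b) REMOVED and the re-cut table**: Assumption 4.3 at `p_I` with `inputsIRev2` gives `NobleInitialInputsOf 𝒮₇ BiRev2 biRev2L`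
— App. D by Level A (`betaLE_corr_inputsIRev2`), the diagram rows by `nobleWeightedDiagramBoundOf_d10_Rev2L_pI`.
[cite: FitznerVanDerHofstad2016NoBLE, Prop. 4.5(ii); Assumption 4.3, closing sentence p. 1088; §3.3.3 (3.31)] [cite: FitznerVanDerHofstad2017, Prop. 2.2 p. 11; §2.4 claims (i)–(ii) p. 13] -/
theorem nobleInitialInputs_d10_Rev2L_of_assumption43
    (hI43 : NobleAssumption43At 10 (nbwThresholdI 10)
      (percolationNobleSplit 10 (nbwThresholdI 10) (by norm_num) (nbwThresholdI_lt_criticalProbI (by norm_num))) inputsIRev2) :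
    NobleInitialInputsOf (nobleTripleSnoc 10 ((1 : ℕ), (17 : ℕ), ({0} : Set (Site 10)))) BiRev2 biRev2L :=
  nobleInitialInputsOf_mono betaLE_corr_inputsIRev2 (fun _ => le_rfl)
    (nobleInitialInputsOf_of_assumption43 (by norm_num) inputsIRev2_WF n1_inputsIRev2 n2_inputsIRev2 n3_inputsIRev2
      n4_inputsIRev2 hI43 nobleWeightedDiagramBoundOf_d10_Rev2L_pI)

/-- **The RE-CUT numeric certificate at `d = 10` holds**: the eleven closed inequalities of [NoBLE17] Def. 2.9 `P(γ, Γ)` / Prop. 2.11 at the record's tables with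
`bi := biRev2L` (only row `f3_init_le` differs from `nobleCertificate_d10_Rev2`: `bi₅/c₅ = 0.18603`, `bi₆/c₆ = 0.16639 ≤ γ₃ = 0.9687444971`).
[cite: FitznerVanDerHofstad2016NoBLE, Def. 2.9, Prop. 2.11, Assumption 2.7] -/
theorem nobleCertificate_d10_Rev2L : NobleNumericCertificateOf 10 cMuRev2 cWeightsRev2 gammaRev2 GammaRev2 BiRev2 BoRev2 biRev2L boRev2 where
  one_lt_cμ := nobleCertificate_d10_Rev2.one_lt_cμ
  c_pos := nobleCertificate_d10_Rev2.c_pos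
  γ_lt_Γ := nobleCertificate_d10_Rev2.γ_lt_Γ
  admissible_init := nobleCertificate_d10_Rev2.admissible_init
  admissible := nobleCertificate_d10_Rev2.admissible
  f1Bound_init_le := nobleCertificate_d10_Rev2.f1Bound_init_le
  f2Bound_init_le := nobleCertificate_d10_Rev2.f2Bound_init_le
  f3_init_le := by intro k; fin_cases k <;> (simp only [biRev2L, cWeightsRev2, gammaRev2, Matrix.cons_val]; norm_num)
  f1Bound_le := nobleCertificate_d10_Rev2.f1Bound_le
  f2Bound_le := nobleCertificate_d10_Rev2.f2Bound_le
  f3_le := nobleCertificate_d10_Rev2.f3_le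

/-! ## §4  The `d = 10` sentences at LEVEL B (conditional on Assumption 4.3 at the two input records ONLY) -/

/-- **`d = 10`, LEVEL B**: the triangle condition, `θ(p_c) = 0` and `β = 1` (bounded-ratio sense) on `ℤ¹⁰`, CONDITIONAL ON (S2a) ONLY — Assumption 4.3 of [NoBLE17]
for percolation at `p_I` with `inputsIRev2` and, under `f^{𝒮₇} ≤ GammaRev2` on `(p_I, p_c)` and kernel-validity of `R18`, with `inputsORev2`.  Both (S2b)
diagram-row conjuncts of Level A are DISCHARGED in the kernel (§2, §3); the certificate is the re-cut `nobleCertificate_d10_Rev2L`.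
[cite: FitznerVanDerHofstad2016NoBLE, Thm. 2.10, Prop. 2.11, Def. 2.9 pp. 1060–1062; Prop. 4.5(ii) p. 1088] [cite: FitznerVanDerHofstad2017, Thm. 1.1, Cor. 1.3, Prop. 2.2] -/
theorem meanField_d10_Rev2L_f3
    (hI43 : NobleAssumption43At 10 (nbwThresholdI 10)
      (percolationNobleSplit 10 (nbwThresholdI 10) (by norm_num) (nbwThresholdI_lt_criticalProbI (by norm_num))) inputsIRev2)
    (hS43 : (RemValid 10 18 fun r => ((RemCertD10.R18 r : ℚ) : ℝ)) →
      ∀ (p : unitInterval) (hp : p ∈ Set.Ioo (nbwThresholdI 10) (criticalProbI 10)),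
        (∀ j, nobleFOf (nobleTripleSnoc 10 ((1 : ℕ), (17 : ℕ), ({0} : Set (Site 10)))) cMuRev2 cWeightsRev2 j p ≤ GammaRev2 j) →
          NobleAssumption43At 10 p (percolationNobleSplit 10 p (by norm_num) hp.2) inputsORev2) :
    TriangleCondition 10 ∧ PercolationContinuity 10 ∧ BetaEqOneBoundedRatio 10 :=
  meanField_of_certificateOf (by norm_num) nobleCertificate_d10_Rev2L (nobleInitialInputs_d10_Rev2L_of_assumption43 hI43)
    (nobleImprovementInputs_d10_Rev2_f3 hS43 RemCertD10.remValid_d10_cs18)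

/-- **`d = 10`, LEVEL B: `MeanField 10`** under the same two (S2a) binders. [cite: FitznerVanDerHofstad2017, Thm. 1.1 and Cor. 1.3 (shape of the conclusion)] -/
theorem meanField_full_d10_Rev2L_f3
    (hI43 : NobleAssumption43At 10 (nbwThresholdI 10)
      (percolationNobleSplit 10 (nbwThresholdI 10) (by norm_num) (nbwThresholdI_lt_criticalProbI (by norm_num))) inputsIRev2)
    (hS43 : (RemValid 10 18 fun r => ((RemCertD10.R18 r : ℚ) : ℝ)) →
      ∀ (p : unitInterval) (hp : p ∈ Set.Ioo (nbwThresholdI 10) (criticalProbI 10)),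
        (∀ j, nobleFOf (nobleTripleSnoc 10 ((1 : ℕ), (17 : ℕ), ({0} : Set (Site 10)))) cMuRev2 cWeightsRev2 j p ≤ GammaRev2 j) →
          NobleAssumption43At 10 p (percolationNobleSplit 10 p (by norm_num) hp.2) inputsORev2) :
    MeanField 10 :=
  meanField_of_triangle (by norm_num) (meanField_d10_Rev2L_f3 hI43 hS43).1

/-- **`d = 10`, LEVEL B: the NoBLE infrared bound `NobleBootstrapBound 10`** under the same two (S2a) binders. [cite: FitznerVanDerHofstad2016NoBLE, Thm. 2.10 (2.17) p. 1060] -/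
theorem nobleBootstrapBound_d10_Rev2L_f3
    (hI43 : NobleAssumption43At 10 (nbwThresholdI 10)
      (percolationNobleSplit 10 (nbwThresholdI 10) (by norm_num) (nbwThresholdI_lt_criticalProbI (by norm_num))) inputsIRev2)
    (hS43 : (RemValid 10 18 fun r => ((RemCertD10.R18 r : ℚ) : ℝ)) →
      ∀ (p : unitInterval) (hp : p ∈ Set.Ioo (nbwThresholdI 10) (criticalProbI 10)),
        (∀ j, nobleFOf (nobleTripleSnoc 10 ((1 : ℕ), (17 : ℕ), ({0} : Set (Site 10)))) cMuRev2 cWeightsRev2 j p ≤ GammaRev2 j) →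
          NobleAssumption43At 10 p (percolationNobleSplit 10 p (by norm_num) hp.2) inputsORev2) :
    NobleBootstrapBound 10 :=
  nobleBootstrapBound_of_certificateOf (by norm_num) nobleCertificate_d10_Rev2L (nobleInitialInputs_d10_Rev2L_of_assumption43 hI43)
    (nobleImprovementInputs_d10_Rev2_f3 hS43 RemCertD10.remValid_d10_cs18)

/-- The ladder step at LEVEL B: with (S2a) at the two input records, «∀ d ≥ 11, TriangleCondition d» upgrades to «∀ d ≥ 10, TriangleCondition d».
[cite: FitznerVanDerHofstad2017, Thm. 1.1 and Cor. 1.3 pp. 5–6 (shape of the conclusion)] -/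
theorem triangleConditionFrom_d10_Rev2L_f3
    (hI43 : NobleAssumption43At 10 (nbwThresholdI 10)
      (percolationNobleSplit 10 (nbwThresholdI 10) (by norm_num) (nbwThresholdI_lt_criticalProbI (by norm_num))) inputsIRev2)
    (hS43 : (RemValid 10 18 fun r => ((RemCertD10.R18 r : ℚ) : ℝ)) →
      ∀ (p : unitInterval) (hp : p ∈ Set.Ioo (nbwThresholdI 10) (criticalProbI 10)),
        (∀ j, nobleFOf (nobleTripleSnoc 10 ((1 : ℕ), (17 : ℕ), ({0} : Set (Site 10)))) cMuRev2 cWeightsRev2 j p ≤ GammaRev2 j) →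
          NobleAssumption43At 10 p (percolationNobleSplit 10 p (by norm_num) hp.2) inputsORev2)
    (h11 : Summit.CriticalPhenomena.LaceExpansionHighD.TriangleConditionFrom 11) :
    Summit.CriticalPhenomena.LaceExpansionHighD.TriangleConditionFrom 10 :=
  Summit.CriticalPhenomena.LaceExpansionHighD.triangleConditionFrom_of_rung (meanField_d10_Rev2L_f3 hI43 hS43).1 h11

end D10

end Summit.CriticalPhenomena.LaceExpansionHighD

end
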